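import Summits.CriticalPhenomena.PercolationContinuityZ3.Theorems.Transplant.FKDoubleFanMultifanCone
import HarnessLib

/-!
# Double fans `K₂ ∨ P_{m+1}`: the SIGN ORTHANT of the MULTIFAN₁ images — certificates C (`yv ≥ 0` (146 terms))

Helper file (`--supports stmt-CriticalPhenomena-4575`), FK sub-lane `prim-bschramm-fk-3` (gen 44); builds on p205010 (kernel theorem, internal
audit signed; external expert review pending).  No named facts, no sorries; standard axioms.  Memo `bschramm/prim-bschramm-fk-3/FAR-CROSS-XIX.md` §2g.

Continuation of `…MultifanSignsCertA`: further coordinates of the sign orthant of the MULTIFAN₁ images `imgAB q F G u` (`F, G, u` with the eight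
`Valid` inequalities, `0 ≤ q ≤ 1`) as explicit q-parametric product-form identities `= Σ c_j · (1−q)^i q^j (2−q)^k · (valid form of F) · (valid form
of G) · (valid form of u)`, `c_j ≥ 0` rational (LP over the trilinear products of the 22 valid forms per leg, kit j294716, exact rational
verification): **`imgAB_yv_nonneg`**.  `maxHeartbeats` is raised for the `ring` normalisations of the long right-hand sides.
[folklore]
-/

noncomputable section

namespace Summit.CriticalPhenomena.PercolationContinuityZ3.Theorems

namespace FK

namespace ThreeApex

set_option maxHeartbeats 2000000 in
/-- `(imgAB)_yv ≥ 0` for the MULTIFAN₁ image: the certificate identity (146 terms, non-negative combination of `q`-factors and valid forms of the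
three legs; product-form LP, kit j294716, exact rational verification). [folklore] -/
theorem imgAB_yv_nonneg_eq (q : ℝ) (F G u : V5) :
    (imgAB q F G u).yv =
      (1 : ℝ) * (F.z0 * F.z0) * masterN q G * masterN q (swapAB u)
      + (1 : ℝ) * (F.z0 * F.z0) * masterN q (swapBC G) * masterN q (swapAB u)
      + (1 : ℝ) / 3 * (F.z0 * F.zab) * masterN q (swapBC G) * masterN q (swapAB u)
      + (2 : ℝ) / 3 * (F.z0 * F.zac) * masterN q (swapBC G) * masterN q (swapAB u)
      + (1 : ℝ) * (F.z0 * F.zbc) * masterN q (swapBC G) * masterN q (swapAB u)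
      + (2 : ℝ) / 3 * (F.zac * F.zbc) * masterN q (swapBC G) * masterN q (swapAB u)
      + (1 : ℝ) * masterN q F * (G.z0 * G.z0) * masterN q (swapAB u)
      + (1 : ℝ) * masterN q F * (G.z0 * G.zbc) * masterN q (swapAB u)
      + (1 : ℝ) * masterN q F * (G.zac * G.zbc) * masterN q (swapAB u)
      + (1 : ℝ) * masterN q F * masterN q (swapBC G) * (u.z0 * u.z0)
      + (1 : ℝ) * masterN q F * masterN q (swapBC G) * (u.z0 * u.zab)
      + (1 : ℝ) * masterN q F * masterN q (swapBC G) * masterN q (swapAB u)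
      + (2 : ℝ) / 3 * kap (swapBC F) * masterN q (swapBC G) * masterN q (swapAB u)
      + (1 : ℝ) / 2 * (2 - q) * (F.z0 * F.zac) * kap G * masterN q (swapAB u)
      + (1 : ℝ) / 2 * (2 - q) * (F.z0 * F.zbc) * masterN q G * masterN q (swapAB u)
      + (1 : ℝ) / 6 * (2 - q) * (F.z0 * F.z1) * (G.z0 * G.zac) * masterN q (swapAB u)
      + (1 : ℝ) / 3 * (2 - q) * (F.z0 * F.z1) * (G.zab * G.zbc) * masterN q (swapAB u)
      + (1 : ℝ) / 6 * (2 - q) * (F.zab * F.zbc) * masterN q (swapBC G) * masterN q (swapAB u)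
      + (1 : ℝ) / 6 * (2 - q) * (F.zab * F.zbc) * kap (swapBC G) * masterN q (swapAB u)
      + (1 : ℝ) / 2 * (2 - q) * masterN q F * (G.z0 * G.zac) * masterN q (swapAB u)
      + (1 : ℝ) / 2 * (2 - q) * masterN q F * masterN q (swapBC G) * (u.z0 * u.zbc)
      + (1 : ℝ) / 2 * (2 - q) * masterN q F * masterN q (swapBC G) * (u.zab * u.zbc)
      + (1 : ℝ) / 2 * (2 - q) * masterN q F * masterN q (swapBC G) * kap u
      + (1 : ℝ) / 2 * (2 - q) * masterN q F * masterN q (swapBC G) * kap (swapAB u)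
      + (1 : ℝ) * (2 - q) * masterN q F * kap (swapBC G) * masterN q (swapAB u)
      + (1 : ℝ) / 2 * (2 - q) * masterN q (swapAB F) * (G.z0 * G.zab) * masterN q (swapAB u)
      + (1 : ℝ) / 2 * (2 - q) * masterN q (swapAB F) * masterN q G * masterN q (swapAB u)
      + (1 : ℝ) / 2 * (2 - q) * kap (swapBC F) * masterN q G * masterN q (swapAB u)
      + (1 : ℝ) / 2 * (2 - q) ^ 2 * (F.z0 * F.z0) * (G.zab * G.zac) * masterN q (swapAB u)
      + (1 : ℝ) / 2 * (2 - q) ^ 2 * (F.z0 * F.z0) * lam G * masterN q (swapAB u)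
      + (1 : ℝ) / 4 * (2 - q) ^ 2 * (F.z0 * F.zab) * (G.zab * G.zac) * masterN q (swapAB u)
      + (1 : ℝ) / 4 * (2 - q) ^ 2 * (F.z0 * F.zac) * masterN q G * masterN q (swapAB u)
      + (1 : ℝ) / 6 * (2 - q) ^ 2 * (F.z0 * F.zac) * kap (swapBC G) * masterN q (swapAB u)
      + (1 : ℝ) / 12 * (2 - q) ^ 2 * (F.z0 * F.zbc) * kap G * masterN q (swapAB u)
      + (1 : ℝ) / 4 * (2 - q) ^ 2 * (F.z0 * F.zbc) * kap (swapBC G) * masterN q (swapAB u)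
      + (1 : ℝ) / 6 * (2 - q) ^ 2 * (F.z0 * F.z1) * (G.z0 * G.zab) * masterN q (swapAB u)
      + (1 : ℝ) / 12 * (2 - q) ^ 2 * (F.z0 * F.z1) * (G.zac * G.zbc) * masterN q (swapAB u)
      + (1 : ℝ) / 4 * (2 - q) ^ 2 * (F.zab * F.zac) * lam G * masterN q (swapAB u)
      + (1 : ℝ) / 6 * (2 - q) ^ 2 * (F.zab * F.zac) * kap G * masterN q (swapAB u)
      + (1 : ℝ) / 12 * (2 - q) ^ 2 * (F.zab * F.zbc) * lam G * masterN q (swapAB u)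
      + (1 : ℝ) / 2 * (2 - q) ^ 2 * (F.zac * F.zbc) * (G.z0 * G.z0) * masterN q (swapAB u)
      + (1 : ℝ) / 4 * (2 - q) ^ 2 * (F.zac * F.zbc) * (G.z0 * G.zab) * masterN q (swapAB u)
      + (1 : ℝ) / 2 * (2 - q) ^ 2 * (F.zac * F.zbc) * (G.z0 * G.zbc) * masterN q (swapAB u)
      + (1 : ℝ) / 4 * (2 - q) ^ 2 * (F.zac * F.zbc) * (G.zab * G.zbc) * masterN q (swapAB u)
      + (1 : ℝ) / 4 * (2 - q) ^ 2 * (F.zac * F.zbc) * masterN q G * masterN q (swapAB u)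
      + (1 : ℝ) / 4 * (2 - q) ^ 2 * (F.zac * F.zbc) * kap G * masterN q (swapAB u)
      + (1 : ℝ) / 4 * (2 - q) ^ 2 * masterN q (swapAB F) * (G.z0 * G.z0) * masterN q (swapAB u)
      + (1 : ℝ) / 4 * (2 - q) ^ 2 * masterN q (swapAB F) * (G.z0 * G.zbc) * masterN q (swapAB u)
      + (1 : ℝ) / 4 * (2 - q) ^ 2 * masterN q (swapAB F) * (G.zab * G.zbc) * masterN q (swapAB u)
      + (1 : ℝ) / 2 * (2 - q) ^ 2 * masterN q (swapAB F) * kap G * masterN q (swapAB u)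
      + (1 : ℝ) / 2 * (2 - q) ^ 2 * lam F * (G.z0 * G.z0) * masterN q (swapAB u)
      + (1 : ℝ) / 4 * (2 - q) ^ 2 * lam F * (G.z0 * G.zab) * masterN q (swapAB u)
      + (1 : ℝ) / 4 * (2 - q) ^ 2 * lam F * (G.z0 * G.zac) * masterN q (swapAB u)
      + (1 : ℝ) / 4 * (2 - q) ^ 2 * lam F * (G.z0 * G.zbc) * masterN q (swapAB u)
      + (1 : ℝ) / 4 * (2 - q) ^ 2 * lam F * kap (swapAB G) * masterN q (swapAB u)
      + (1 : ℝ) / 3 * (2 - q) ^ 2 * kap F * masterN q (swapBC G) * masterN q (swapAB u)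
      + (1 : ℝ) / 4 * (2 - q) ^ 2 * kap F * kap G * masterN q (swapAB u)
      + (1 : ℝ) / 4 * (2 - q) ^ 2 * kap (swapBC F) * (G.zab * G.zac) * masterN q (swapAB u)
      + (1 : ℝ) / 4 * (2 - q) ^ 2 * kap (swapAB F) * masterN q G * masterN q (swapAB u)
      + (1 : ℝ) / 4 * (2 - q) ^ 2 * kap (swapAB F) * kap G * masterN q (swapAB u)
      + (1 : ℝ) / 4 * (2 - q) ^ 2 * kap (swapAB F) * kap (swapBC G) * masterN q (swapAB u)
      + (1 : ℝ) * q * (F.z0 * F.z0) * (G.z0 * G.zab) * masterN q (swapAB u)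
      + (1 : ℝ) * q * (F.z0 * F.zab) * (G.z0 * G.zab) * masterN q (swapAB u)
      + (1 : ℝ) * q * (F.z0 * F.zab) * (G.z0 * G.zac) * masterN q (swapAB u)
      + (1 : ℝ) / 2 * q * (F.z0 * F.zab) * masterN q G * masterN q (swapAB u)
      + (1 : ℝ) * q * (F.z0 * F.zac) * (G.z0 * G.z0) * masterN q (swapAB u)
      + (2 : ℝ) / 3 * q * (F.z0 * F.zac) * (G.z0 * G.zab) * masterN q (swapAB u)
      + (2 : ℝ) / 3 * q * (F.z0 * F.zac) * (G.z0 * G.zbc) * masterN q (swapAB u)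
      + (1 : ℝ) / 3 * q * (F.z0 * F.zac) * (G.zab * G.zbc) * masterN q (swapAB u)
      + (1 : ℝ) / 2 * q * (F.z0 * F.zac) * masterN q G * masterN q (swapAB u)
      + (1 : ℝ) * q * (F.z0 * F.zbc) * (G.z0 * G.zbc) * masterN q (swapAB u)
      + (1 : ℝ) / 6 * q * (F.zab * F.zbc) * (G.z0 * G.zac) * masterN q (swapAB u)
      + (1 : ℝ) / 6 * q * (F.zab * F.zbc) * masterN q (swapBC G) * masterN q (swapAB u)
      + (1 : ℝ) / 2 * q * masterN q F * (G.z0 * G.zac) * masterN q (swapAB u)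
      + (1 : ℝ) / 2 * q * masterN q F * masterN q (swapBC G) * (u.zab * u.zac)
      + (1 : ℝ) / 2 * q * masterN q (swapAB F) * (G.z0 * G.z0) * masterN q (swapAB u)
      + (1 : ℝ) / 2 * q * masterN q (swapAB F) * masterN q G * masterN q (swapAB u)
      + (1 : ℝ) / 2 * q * (2 - q) * (F.z0 * F.z0) * (G.zab * G.zbc) * masterN q (swapAB u)
      + (1 : ℝ) / 2 * q * (2 - q) * (F.z0 * F.z0) * kap G * masterN q (swapAB u)
      + (1 : ℝ) / 2 * q * (2 - q) * (F.z0 * F.zab) * (G.z0 * G.z1) * masterN q (swapAB u)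
      + (1 : ℝ) / 12 * q * (2 - q) * (F.z0 * F.zac) * (G.z0 * G.zac) * masterN q (swapAB u)
      + (1 : ℝ) / 12 * q * (2 - q) * (F.z0 * F.zac) * kap G * masterN q (swapAB u)
      + (1 : ℝ) / 2 * q * (2 - q) * (F.z0 * F.zbc) * (G.z0 * G.z0) * masterN q (swapAB u)
      + (1 : ℝ) / 2 * q * (2 - q) * (F.z0 * F.zbc) * (G.z0 * G.zab) * masterN q (swapAB u)
      + (1 : ℝ) / 2 * q * (2 - q) * (F.z0 * F.zbc) * (G.zab * G.zbc) * masterN q (swapAB u)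
      + (1 : ℝ) / 4 * q * (2 - q) * (F.z0 * F.zbc) * masterN q G * masterN q (swapAB u)
      + (1 : ℝ) / 6 * q * (2 - q) * (F.z0 * F.zbc) * kap G * masterN q (swapAB u)
      + (1 : ℝ) / 2 * q * (2 - q) * (F.z0 * F.z1) * (G.z0 * G.z0) * masterN q (swapAB u)
      + (1 : ℝ) / 3 * q * (2 - q) * (F.z0 * F.z1) * (G.z0 * G.zab) * masterN q (swapAB u)
      + (1 : ℝ) / 3 * q * (2 - q) * (F.z0 * F.z1) * (G.z0 * G.zbc) * masterN q (swapAB u)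
      + (1 : ℝ) / 3 * q * (2 - q) * (F.zab * F.zac) * kap G * masterN q (swapAB u)
      + (1 : ℝ) / 4 * q * (2 - q) * (F.zab * F.zbc) * masterN q G * masterN q (swapAB u)
      + (1 : ℝ) / 12 * q * (2 - q) * (F.zab * F.zbc) * kap (swapBC G) * masterN q (swapAB u)
      + (1 : ℝ) / 6 * q * (2 - q) * (F.zab * F.zbc) * kap (swapAB G) * masterN q (swapAB u)
      + (1 : ℝ) / 4 * q * (2 - q) * (F.zac * F.zbc) * masterN q G * masterN q (swapAB u)
      + (1 : ℝ) / 4 * q * (2 - q) * masterN q F * masterN q (swapBC G) * (u.z0 * u.zac)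
      + (1 : ℝ) / 4 * q * (2 - q) * masterN q (swapAB F) * (G.z0 * G.z0) * masterN q (swapAB u)
      + (1 : ℝ) / 4 * q * (2 - q) * masterN q (swapAB F) * (G.z0 * G.zab) * masterN q (swapAB u)
      + (1 : ℝ) / 2 * q * (2 - q) * masterN q (swapAB F) * (G.z0 * G.zbc) * masterN q (swapAB u)
      + (1 : ℝ) / 2 * q * (2 - q) * masterN q (swapAB F) * (G.zab * G.zbc) * masterN q (swapAB u)
      + (1 : ℝ) / 2 * q * (2 - q) * masterN q (swapAB F) * kap G * masterN q (swapAB u)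
      + (1 : ℝ) / 12 * q * (2 - q) * kap F * (G.z0 * G.zac) * masterN q (swapAB u)
      + (1 : ℝ) / 6 * q * (2 - q) * kap F * (G.z0 * G.zbc) * masterN q (swapAB u)
      + (1 : ℝ) / 6 * q * (2 - q) * kap F * (G.zab * G.zbc) * masterN q (swapAB u)
      + (1 : ℝ) / 6 * q * (2 - q) * kap F * (G.zac * G.zbc) * masterN q (swapAB u)
      + (1 : ℝ) / 4 * q * (2 - q) * kap F * masterN q G * masterN q (swapAB u)
      + (1 : ℝ) * q ^ 2 * (F.z0 * F.z0) * (G.z0 * G.z0) * masterN q (swapAB u)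
      + (1 : ℝ) / 2 * q ^ 2 * (F.z0 * F.z0) * (G.z0 * G.zac) * masterN q (swapAB u)
      + (1 : ℝ) * q ^ 2 * (F.z0 * F.z0) * (G.z0 * G.zbc) * masterN q (swapAB u)
      + (1 : ℝ) / 2 * q ^ 2 * (F.z0 * F.z0) * (G.zab * G.zbc) * masterN q (swapAB u)
      + (1 : ℝ) / 2 * q ^ 2 * (F.z0 * F.z0) * (G.zac * G.zbc) * masterN q (swapAB u)
      + (1 : ℝ) * q ^ 2 * (F.z0 * F.zab) * (G.z0 * G.z0) * masterN q (swapAB u)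
      + (1 : ℝ) / 2 * q ^ 2 * (F.z0 * F.zab) * (G.z0 * G.zbc) * masterN q (swapAB u)
      + (1 : ℝ) / 2 * q ^ 2 * (F.z0 * F.zab) * kap (swapAB G) * masterN q (swapAB u)
      + (1 : ℝ) / 6 * q ^ 2 * (F.z0 * F.zac) * (G.z0 * G.zab) * masterN q (swapAB u)
      + (1 : ℝ) / 6 * q ^ 2 * (F.z0 * F.zac) * (G.z0 * G.zbc) * masterN q (swapAB u)
      + (1 : ℝ) / 3 * q ^ 2 * (F.z0 * F.zac) * (G.zab * G.zbc) * masterN q (swapAB u)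
      + (1 : ℝ) / 2 * q ^ 2 * (F.z0 * F.zbc) * (G.z0 * G.z0) * masterN q (swapAB u)
      + (1 : ℝ) / 2 * q ^ 2 * (F.z0 * F.zbc) * (G.z0 * G.zac) * masterN q (swapAB u)
      + (1 : ℝ) / 2 * q ^ 2 * (F.z0 * F.zbc) * (G.zac * G.zbc) * masterN q (swapAB u)
      + (1 : ℝ) / 2 * q ^ 2 * (F.zab * F.zac) * (G.z0 * G.z0) * masterN q (swapAB u)
      + (1 : ℝ) / 2 * q ^ 2 * (F.zab * F.zac) * (G.z0 * G.zab) * masterN q (swapAB u)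
      + (1 : ℝ) / 2 * q ^ 2 * (F.zab * F.zac) * (G.z0 * G.zbc) * masterN q (swapAB u)
      + (1 : ℝ) / 2 * q ^ 2 * (F.zab * F.zac) * (G.zab * G.zbc) * masterN q (swapAB u)
      + (1 : ℝ) / 4 * q ^ 2 * (F.zab * F.zac) * masterN q G * masterN q (swapAB u)
      + (1 : ℝ) / 2 * q ^ 2 * (F.zab * F.zbc) * (G.z0 * G.z0) * masterN q (swapAB u)
      + (5 : ℝ) / 12 * q ^ 2 * (F.zab * F.zbc) * (G.z0 * G.zac) * masterN q (swapAB u)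
      + (1 : ℝ) / 2 * q ^ 2 * (F.zab * F.zbc) * (G.z0 * G.zbc) * masterN q (swapAB u)
      + (1 : ℝ) / 2 * q ^ 2 * (F.zab * F.zbc) * (G.zac * G.zbc) * masterN q (swapAB u)
      + (1 : ℝ) / 4 * q ^ 2 * masterN q F * masterN q (swapBC G) * (u.z0 * u.zac)
      + (1 : ℝ) / 4 * q ^ 2 * masterN q (swapAB F) * (G.z0 * G.zab) * masterN q (swapAB u)
      + (1 : ℝ) / 4 * q ^ 2 * masterN q (swapAB F) * (G.z0 * G.zbc) * masterN q (swapAB u)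
      + (1 : ℝ) / 4 * q ^ 2 * masterN q (swapAB F) * (G.zab * G.zbc) * masterN q (swapAB u)
      + (2 : ℝ) * (1 - q) * (F.z0 * F.zab) * lam G * masterN q (swapAB u)
      + (1 : ℝ) / 3 * (1 - q) * (2 - q) * (F.zab * F.zbc) * lam G * masterN q (swapAB u)
      + (1 : ℝ) * (1 - q) * (2 - q) * (F.zac * F.zbc) * (G.z0 * G.zab) * kap (swapAB u)
      + (1 : ℝ) * (1 - q) * (2 - q) * (F.zac * F.zbc) * (G.zab * G.zbc) * kap (swapAB u)
      + (1 : ℝ) * (1 - q) * (2 - q) * masterN q F * kap (swapBC G) * kap (swapAB u)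
      + (1 : ℝ) * (1 - q) * (2 - q) * lam F * (G.z0 * G.zab) * kap (swapAB u)
      + (1 : ℝ) * (1 - q) * (2 - q) * lam F * (G.zab * G.zbc) * kap (swapAB u)
      + (1 : ℝ) * (1 - q) * (2 - q) * kap F * (G.zab * G.zab) * kap (swapAB u)
      + (1 : ℝ) * (1 - q) * (2 - q) * kap F * (G.zab * G.zac) * kap (swapAB u)
      + (1 : ℝ) * (1 - q) * (2 - q) * kap F * (G.zab * G.z1) * kap (swapAB u)
      + (2 : ℝ) / 3 * (1 - q) * (2 - q) * kap F * kap (swapBC G) * masterN q (swapAB u)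
      + (1 : ℝ) / 3 * (1 - q) * (2 - q) * kap (swapAB F) * kap G * masterN q (swapAB u)
      + (1 : ℝ) / 3 * (1 - q) * q * kap F * masterN q (swapBC G) * masterN q (swapAB u) := by
  simp only [imgAB, wedgeH, fanComboB, fanCombo, conv, edgeAC, edgeBC, detach, V5.total, hx, hy, hz, masterN, kap, lam, swapAB, swapBC]
  ring

set_option maxHeartbeats 2000000 in
/-- `(imgAB)_yv ≥ 0` for every MULTIFAN₁ image over `Valid³` (`0 ≤ q ≤ 1`). [folklore] -/
theorem imgAB_yv_nonneg {q : ℝ} {F G u : V5} (hq0 : 0 ≤ q) (hq1 : q ≤ 1) (hF : Valid q F) (hG : Valid q G) (hu : Valid q u) :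
    0 ≤ (imgAB q F G u).yv := by
  obtain ⟨⟨hF0, hFab, hFac, hFbc, hF1⟩, hFN, hFNab, hFNbc, hFL, hFk, hFkb, hFkc⟩ := hF
  obtain ⟨⟨hG0, hGab, hGac, hGbc, hG1⟩, hGN, hGNab, hGNbc, hGL, hGk, hGkb, hGkc⟩ := hG
  obtain ⟨⟨hu0, huab, huac, hubc, hu1⟩, huN, huNab, huNbc, huL, huk, hukb, hukc⟩ := hu
  have hp : 0 ≤ 1 - q := by linarith
  have hr : 0 ≤ 2 - q := by linarith
  rw [imgAB_yv_nonneg_eq]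
  positivity

end ThreeApex

end FK

end Summit.CriticalPhenomena.PercolationContinuityZ3.Theorems
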